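/-
Copyright: the b2b-balaban T⁴-continuum CRUX team, row NE7b leaf lineage `t4-ne7b-formalise-leaf-03` (gen 144). Project licence.
-/
import Mathlib.Analysis.InnerProductSpace.Adjoint
import Mathlib.Data.Real.Pointwise

/-!
# THE HARD-CONSTRAINT SCHUR FORM: the sharp base form of a LINEAR CONSTRAINT `D δ = w` — `w ↦ inf {Q δ : D δ = w}` — generalising
# `…ConvexityModulusSchur` §3–§4 from the product split `D = Prod.fst` to an arbitrary constraint map; for a quadratic `Q = ⟪·, H ·⟫` it is
# attained at a constrained minimiser `M` (`D M = 1`, `H M ⊥ ker D`) and equals the MULTIPLIER FORM `⟪w, Λ w⟫` whenever `H M = D† Λ`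
# («`(D H⁻¹ D†)⁻¹` without inverses»); existence of `(M, Λ)` in finite dimension; floors transfer with `γ∕q²`
# (row NE7b, node U5c; residual (R2′) family (2), letter (ℓ1); T-80 (J1)'s algebraic core — kernel lemmas of linear algebra, Mathlib only)

Cell `pub-balaban`, sub-cell `t4`, spine estimate NE7b (`T4WeightBudget.RelWeightBound`; the cell's OWN estimate — NOT PRINTED in
[Bałaban 1983–89], NOT PROVED).  Crux-route work under `Spine/NE7b/` by a row leaf on the convexity road; NOTHING of Bałaban's is named
or asserted; no `T4Continuum/Support` leaf typed; no `def`; zero `sorry`.  Imports: Mathlib only — independent of the farm's olean frontier.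

WHY.  T-80 (idea-1 g80, `t4/ideate/NE7b/checks-g80/…` §3) names as junction cell (J1) of R-P1's debt (i) the SENSITIVITY of a constrained
minimum: with the HARD constraint «`Ū = V`» the value `φ(V) = min {A(U) : Ū = V}` has second variation
`D²φ(V)[w, w] = inf {⟨δU, ∇²A δU⟩ : DŪ·δU = w}` (+ a multiplier term) — «the CONSTRAINED SCHUR COMPLEMENT of the fine quadratic term, i.e. the
`a → ∞` member of the averaging-weight family; tree currency `ConvexityModulusSchur` §3 (`iInf_fibre`) ∕ §7».  But `…ConvexityModulusSchur`
eliminates a PRODUCT fibre only (`x ↦ ⨅ y, Q(x, y)`, constraint map `Prod.fst`), while an averaging constraint `D` is a general surjection;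
and the SOFT members (weight `a‖x − P y‖²`, finite `a`) are the sibling files `…ComplementaryEliminationFloor` (leaf-04; floor
`min(a∕4, γ∕(4q²))` from two separate letters) and `…AveragingFloorTower` (the sharp summed floor `aγ∕(γ + aq²)` and its tower) — floors
only, no hard constraint.  THIS FILE types the constrained (`a = ∞`) sharp form itself, `w ↦ ⨅ δ : {δ // D δ = w}, Q δ`, and its
quadratic-model algebra: (§1) the infimal API and the reduction to `…ConvexityModulusSchur` §3
when `D = Prod.fst`; (§2) the floor transfer `γ‖δ‖² ≤ Q δ`, `‖D δ‖ ≤ q‖δ‖` ⟹ `(γ∕q²)‖w‖²` and 2-homogeneity; (§3) for `Q δ = ⟪δ, H δ⟫`,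
`H` symmetric, and a constrained minimiser `M : F → E` given as DATA by its two algebraic letters — `D (M w) = w` and the LAGRANGE letter
`⟪H (M w), κ⟫ = 0` for `D κ = 0` — Pythagoras along the fibre, domination (`H ≥ 0`), attainment, `⨅ = ⟪M w, H (M w)⟫`, and with a
multiplier map `Λ` such that `⟪H (M w), δ⟫ = ⟪Λ w, D δ⟫` (i.e. `H M = D† Λ`) the MULTIPLIER FORM `⨅ = ⟪w, Λ w⟫` — for invertible `H` and
surjective `D` this `Λ` is `(D H⁻¹ D†)⁻¹`, the constrained Schur complement, but no inverse is taken here; (§4) EXISTENCE of such `(M, Λ)`,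
both linear, in finite dimension for `H` positive definite and `D` surjective (`Λ = (D H⁻¹ D†)⁻¹`, `M = H⁻¹ D† Λ` via Mathlib's
`LinearMap.adjoint` and `LinearEquiv.ofBijective`); (§5) the soft members are dominated by the hard one: `⨅ δ, (Q δ + a‖D δ − w‖²) ≤ ⨅_{D δ = w} Q δ`;
(§6) beyond the quadratic model: for ANY `V` obeying the road's secant letter with a modulus form `Q` on a convex window `K`, the constrained
VALUE FUNCTION `w ↦ inf {V δ : δ ∈ K, D δ = w}` obeys the secant letter with the constrained Schur form of `Q` — minimisation over a fibre
transports the modulus exactly as `…LogConcaveMarginal` §6's integration over a fibre does.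

WHAT IS PROVED ([folklore] linear algebra; Mathlib only):
* §1 `constrInf_le` ∕ `le_constrInf` ∕ `constrInf_nonneg` (the constrained infimal form: dominated by `Q` on the fibre, dominates every
  fibrewise floor, `≥ 0`); **`constrInf_fst_eq_iInf_fibre`** (`D = Prod.fst`: `⨅ δ : {δ // δ.1 = x}, Q δ = ⨅ y, Q (x, y)` — the
  `…ConvexityModulusSchur` §3 form is the product case).
* §2 **`floor_constrInf`** (`γ‖δ‖² ≤ Q δ`, `‖D δ‖ ≤ q‖δ‖`, fibre non-empty ⟹ `(γ∕q²)·‖w‖² ≤ ⨅_{D δ = w} Q δ`); `constrInf_smul`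
  (`D` linear, `Q` 2-homogeneous `≥ 0` ⟹ `⨅_{D δ = t•w} Q = t²·⨅_{D δ = w} Q`).
* §3 quadratic model `Q δ = ⟪δ, H δ⟫`, `hH : ⟪H u, v⟫ = ⟪u, H v⟫`, minimiser data `hM : D (M w) = w`, `hMK : D κ = 0 → ⟪H (M w), κ⟫ = 0`:
  **`quadForm_eq_min_add`** (Pythagoras: `D δ = w → ⟪δ, H δ⟫ = ⟪M w, H (M w)⟫ + ⟪δ − M w, H (δ − M w)⟫`), `min_le_quadForm` (`H ≥ 0`),
  **`constrInf_quadForm_eq`** (`⨅_{D δ = w} ⟪δ, H δ⟫ = ⟪M w, H (M w)⟫`), `lagrange_of_multiplier` (the multiplier letter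
  `⟪H (M w), δ⟫ = ⟪Λ w, D δ⟫` implies `hMK`), **`min_eq_multiplierForm`** (`⟪M w, H (M w)⟫ = ⟪w, Λ w⟫`) and
  **`constrInf_quadForm_eq_multiplierForm`** (`⨅_{D δ = w} ⟪δ, H δ⟫ = ⟪w, Λ w⟫`).
* §4 **`exists_constrMin`** (finite dimension, `H` positive definite, `D` surjective ⟹ `∃ M Λ` linear with `D ∘ M = id` and `H ∘ M = D† ∘ Λ`);
  `adjoint_injective_of_surjective` (bookkeeping).
* §5 `softInf_le_constrInf` (`0 ≤ a` ⟹ `⨅ δ, (Q δ + a‖D δ − w‖²) ≤ ⨅_{D δ = w} Q δ`), `softInf_mono` (monotone in `a`).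
* §6 **`secant_constrInf_of_secant`** — THE MODULUS FORM SURVIVES THE CONSTRAINED MINIMISATION: `V` with the secant letter and a
  modulus form `Q ≥ 0` on a convex `K` ⟹ the value function `w ↦ ⨅ {V δ : δ ∈ K, D δ = w}` obeys the secant letter with the constrained
  Schur form `Q_D (w₂ − w₁) = ⨅_{D δ = w₂ − w₁} Q δ` (any real vector spaces; the `a = ∞` twin of `…LogConcaveMarginal` §6, whose base form for
  `D = Prod.fst` is `…ConvexityModulusSchur` §3's).
* §7 (v2, appended; chair ι-X-CSTF-1) `multiplier_symm` ∕ `multiplier_nonneg` ∕ `multiplier_pos` — from the two letters alone (`D (M w) = w`,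
  `⟪H (M w), δ⟫ = ⟪Λ w, D δ⟫`) the multiplier map inherits symmetry (`H` symmetric), non-negativity (`H ≥ 0`) and positive definiteness
  (`H > 0`): the constrained Schur complement is a symmetric positive definite form, with no construction and no inverse.

NOT HERE (honest): the NONLINEAR sensitivity theorem (second derivative of the value function of a `C²` constrained minimum under
non-degeneracy, with its multiplier term `Λ_V·∇²Ū` — T-80 (J1) proper; implicit-function territory); which `H`, `D` of Bałaban's ((3.26) at
`k+1` levels on the slice `δ_R`, the averaging `Q̄` — (J3), (A3) ∕ (A1c), NC-NE7b-α UNRULED); any value.  BY-NAME EFFECT ON THE WALL: NONE.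
NE7b NOT PRINTED ∕ NOT PROVED; spine PROVED 0∕9; rung (B)+1 on a FINITE torus — NOT infinite volume, NOT the mass gap, NOT Clay.
HONEST DEPENDENCY: continuum YM on T⁴ ⇐ BetaPertH ∧ nine spine estimates (0/9 proved); BetaPertH ⇐ (D1) ∧ (D4) ∧ CAP+tail.
-/

set_option autoImplicit false

open Set Function
open scoped RealInnerProductSpace

namespace Summit.QuantumFields.BalabanUV.T4Continuum.NE7b.ConstrainedSchurForm

/-! ## §1 The constrained sharp form `w ↦ ⨅ δ : {δ // D δ = w}, Q δ` -/

section Infimal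

variable {E F : Type*} {D : E → F} {Q : E → ℝ}

/-- The constrained infimal form is dominated by `Q` on the fibre (`Q ≥ 0` keeps every fibre bounded below). [folklore] -/
theorem constrInf_le (hQ0 : ∀ δ, 0 ≤ Q δ) {w : F} {δ : E} (hδ : D δ = w) :
    (⨅ δ' : {δ' // D δ' = w}, Q δ'.1) ≤ Q δ :=
  ciInf_le ⟨0, forall_mem_range.2 fun δ' => hQ0 δ'.1⟩ (⟨δ, hδ⟩ : {δ' // D δ' = w})

/-- … and dominates every fibrewise floor: on a NON-EMPTY fibre, `(∀ δ, D δ = w → c ≤ Q δ) → c ≤ ⨅_{D δ = w} Q δ`. [folklore] -/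
theorem le_constrInf {w : F} (hw : ∃ δ, D δ = w) {c : ℝ} (h : ∀ δ, D δ = w → c ≤ Q δ) :
    c ≤ ⨅ δ' : {δ' // D δ' = w}, Q δ'.1 := by
  obtain ⟨δ₀, hδ₀⟩ := hw
  haveI : Nonempty {δ' // D δ' = w} := ⟨⟨δ₀, hδ₀⟩⟩
  exact le_ciInf fun δ' => h δ'.1 δ'.2

/-- The constrained infimal form of a non-negative `Q` is non-negative (on any fibre; an empty fibre gives `0` by convention). [folklore] -/
theorem constrInf_nonneg (hQ0 : ∀ δ, 0 ≤ Q δ) (w : F) : 0 ≤ ⨅ δ' : {δ' // D δ' = w}, Q δ'.1 := by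
  rcases isEmpty_or_nonempty {δ' // D δ' = w} with h | h
  · rw [Real.iInf_of_isEmpty]
  · exact le_ciInf fun δ' => hQ0 δ'.1

/-- **THE PRODUCT CASE IS `…ConvexityModulusSchur` §3**: for `D = Prod.fst` on `E₁ × E₂` the constrained sharp form is the fibrewise infimum,
`⨅ δ : {δ // δ.1 = x}, Q δ = ⨅ y, Q (x, y)`. [folklore] -/
theorem constrInf_fst_eq_iInf_fibre {E₁ E₂ : Type*} (Q : E₁ × E₂ → ℝ) (x : E₁) :
    (⨅ δ : {δ : E₁ × E₂ // δ.1 = x}, Q δ.1) = ⨅ y : E₂, Q (x, y) := by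
  have hs : Surjective fun y : E₂ => (⟨(x, y), rfl⟩ : {δ : E₁ × E₂ // δ.1 = x}) := by
    rintro ⟨⟨x', y⟩, hx'⟩
    cases hx'
    exact ⟨y, rfl⟩
  rw [← hs.iInf_comp (fun δ : {δ : E₁ × E₂ // δ.1 = x} => Q δ.1)]

end Infimal

/-! ## §2 Floor transfer and 2-homogeneity of the constrained form -/

section Floor

variable {E F : Type*} [NormedAddCommGroup E] [NormedAddCommGroup F]

/-- **FLOOR TRANSFER THROUGH A CONSTRAINT**: `γ‖δ‖² ≤ Q δ` for all `δ` (`0 ≤ γ`), `‖D δ‖ ≤ q‖δ‖` (`0 < q`) and a non-empty fibre over `w` ⟹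
`(γ∕q²)·‖w‖² ≤ ⨅_{D δ = w} Q δ` — the hard-constraint (`a = ∞`) companion of `…ComplementaryEliminationFloor`'s soft floor, in infimal
currency. [folklore] -/
theorem floor_constrInf {D : E → F} {Q : E → ℝ} {γ q : ℝ} (hγ : 0 ≤ γ) (hq : 0 < q) (hD : ∀ δ, ‖D δ‖ ≤ q * ‖δ‖)
    (hfloor : ∀ δ, γ * ‖δ‖ ^ 2 ≤ Q δ) {w : F} (hw : ∃ δ, D δ = w) :
    γ / q ^ 2 * ‖w‖ ^ 2 ≤ ⨅ δ' : {δ' // D δ' = w}, Q δ'.1 := by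
  refine le_constrInf hw fun δ hδ => ?_
  subst hδ
  have h1 : ‖D δ‖ ^ 2 ≤ q ^ 2 * ‖δ‖ ^ 2 := by rw [← mul_pow]; exact pow_le_pow_left₀ (norm_nonneg _) (hD δ) 2
  calc γ / q ^ 2 * ‖D δ‖ ^ 2 ≤ γ / q ^ 2 * (q ^ 2 * ‖δ‖ ^ 2) := mul_le_mul_of_nonneg_left h1 (by positivity)
    _ = γ * ‖δ‖ ^ 2 := by rw [← mul_assoc, div_mul_cancel₀ _ (by positivity : q ^ 2 ≠ 0)]
    _ ≤ Q δ := hfloor δ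

variable [NormedSpace ℝ E] [NormedSpace ℝ F]

/-- **THE CONSTRAINED FORM OF A 2-HOMOGENEOUS NON-NEGATIVE `Q` IS 2-HOMOGENEOUS** (for a LINEAR constraint map; no surjectivity needed —
an empty fibre over `w` gives an empty fibre over `t • w`, `t ≠ 0`, and both infima are `0` by convention):
`⨅_{D δ = t • w} Q δ = t²·⨅_{D δ = w} Q δ`. [folklore] -/
theorem constrInf_smul (D : E →ₗ[ℝ] F) (Q : E → ℝ) (hQ : ∀ (t : ℝ) (δ : E), Q (t • δ) = t ^ 2 * Q δ)
    (hQ0 : ∀ δ, 0 ≤ Q δ) (t : ℝ) (w : F) :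
    (⨅ δ' : {δ' // D δ' = t • w}, Q δ'.1) = t ^ 2 * ⨅ δ' : {δ' // D δ' = w}, Q δ'.1 := by
  rcases eq_or_ne t 0 with rfl | ht
  · have h00 : Q 0 = 0 := by simpa using hQ 0 0
    rw [zero_smul, sq, zero_mul, zero_mul]
    refine le_antisymm ?_ (constrInf_nonneg hQ0 _)
    calc (⨅ δ' : {δ' // D δ' = (0 : F)}, Q δ'.1) ≤ Q 0 := constrInf_le hQ0 (map_zero D)
      _ = 0 := h00
  · have hs : Surjective fun δ' : {δ' // D δ' = w} => (⟨t • δ'.1, by rw [map_smul, δ'.2]⟩ : {δ' // D δ' = t • w}) := by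
      rintro ⟨δ, hδ⟩
      refine ⟨⟨t⁻¹ • δ, ?_⟩, ?_⟩
      · rw [map_smul, hδ, smul_smul, inv_mul_cancel₀ ht, one_smul]
      · simp [smul_smul, mul_inv_cancel₀ ht]
    calc (⨅ δ' : {δ' // D δ' = t • w}, Q δ'.1)
        = ⨅ δ' : {δ' // D δ' = w}, Q (t • δ'.1) := (hs.iInf_comp fun δ' : {δ' // D δ' = t • w} => Q δ'.1).symm
      _ = ⨅ δ' : {δ' // D δ' = w}, t ^ 2 * Q δ'.1 := iInf_congr fun δ' => hQ t δ'.1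
      _ = t ^ 2 * ⨅ δ' : {δ' // D δ' = w}, Q δ'.1 := (Real.mul_iInf_of_nonneg (sq_nonneg t) _).symm

end Floor

/-! ## §3 The quadratic model: Pythagoras along the fibre, the constrained minimiser as data, the multiplier form -/

section Quadratic

variable {E F : Type*} [NormedAddCommGroup E] [InnerProductSpace ℝ E] [NormedAddCommGroup F] [InnerProductSpace ℝ F]

/-- **PYTHAGORAS ALONG THE FIBRE**: `H` symmetric, `M` a constrained minimiser given by its letters `D (M w) = w` and the LAGRANGE letter
`⟪H (M w), κ⟫ = 0` for every `κ ∈ ker D` ⟹ on the fibre `D δ = w`, `⟪δ, H δ⟫ = ⟪M w, H (M w)⟫ + ⟪δ − M w, H (δ − M w)⟫`. [folklore] -/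
theorem quadForm_eq_min_add (H : E →ₗ[ℝ] E) (hH : ∀ u v : E, ⟪H u, v⟫ = ⟪u, H v⟫) (D : E →ₗ[ℝ] F) (M : F → E)
    (hM : ∀ w, D (M w) = w) (hMK : ∀ (w : F) (κ : E), D κ = 0 → ⟪H (M w), κ⟫ = 0) {w : F} {δ : E} (hδ : D δ = w) :
    ⟪δ, H δ⟫ = ⟪M w, H (M w)⟫ + ⟪δ - M w, H (δ - M w)⟫ := by
  have hκ : D (δ - M w) = 0 := by rw [map_sub, hδ, hM, sub_self]
  have h1 : ⟪H (M w), δ - M w⟫ = 0 := hMK w _ hκ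
  have h2 : ⟪δ - M w, H (M w)⟫ = 0 := by rw [real_inner_comm, h1]
  have h3 : ⟪M w, H (δ - M w)⟫ = 0 := by rw [← hH, h1]
  have e : δ = M w + (δ - M w) := by abel
  conv_lhs => rw [e]
  rw [map_add, inner_add_left, inner_add_right, inner_add_right, h3, h2, add_zero, zero_add]

/-- **DOMINATION**: with `H ≥ 0` the constrained minimiser's value is below `⟪δ, H δ⟫` on the whole fibre. [folklore] -/
theorem min_le_quadForm (H : E →ₗ[ℝ] E) (hH : ∀ u v : E, ⟪H u, v⟫ = ⟪u, H v⟫) (hH0 : ∀ u : E, 0 ≤ ⟪u, H u⟫) (D : E →ₗ[ℝ] F)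
    (M : F → E) (hM : ∀ w, D (M w) = w) (hMK : ∀ (w : F) (κ : E), D κ = 0 → ⟪H (M w), κ⟫ = 0) {w : F} {δ : E} (hδ : D δ = w) :
    ⟪M w, H (M w)⟫ ≤ ⟪δ, H δ⟫ := by
  rw [quadForm_eq_min_add H hH D M hM hMK hδ]
  linarith [hH0 (δ - M w)]

/-- **THE CONSTRAINED SHARP FORM IS ATTAINED AT THE MINIMISER**: `⨅_{D δ = w} ⟪δ, H δ⟫ = ⟪M w, H (M w)⟫`. [folklore] -/
theorem constrInf_quadForm_eq (H : E →ₗ[ℝ] E) (hH : ∀ u v : E, ⟪H u, v⟫ = ⟪u, H v⟫) (hH0 : ∀ u : E, 0 ≤ ⟪u, H u⟫) (D : E →ₗ[ℝ] F)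
    (M : F → E) (hM : ∀ w, D (M w) = w) (hMK : ∀ (w : F) (κ : E), D κ = 0 → ⟪H (M w), κ⟫ = 0) (w : F) :
    (⨅ δ' : {δ' // D δ' = w}, ⟪δ'.1, H δ'.1⟫) = ⟪M w, H (M w)⟫ := by
  refine le_antisymm ?_ (le_constrInf ⟨M w, hM w⟩ fun δ hδ => min_le_quadForm H hH hH0 D M hM hMK hδ)
  exact constrInf_le (Q := fun δ => ⟪δ, H δ⟫) hH0 (hM w)

/-- **THE MULTIPLIER LETTER IMPLIES THE LAGRANGE LETTER**: if `⟪H (M w), δ⟫ = ⟪Λ w, D δ⟫` for all `δ` (i.e. `H M = D† Λ`), then `H (M w) ⊥ ker D`.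
[folklore] -/
theorem lagrange_of_multiplier (H : E →ₗ[ℝ] E) (D : E →ₗ[ℝ] F) (M : F → E) (Λ : F → F)
    (hΛ : ∀ (w : F) (δ : E), ⟪H (M w), δ⟫ = ⟪Λ w, D δ⟫) : ∀ (w : F) (κ : E), D κ = 0 → ⟪H (M w), κ⟫ = 0 := by
  intro w κ hκ
  rw [hΛ, hκ, inner_zero_right]

/-- **THE MULTIPLIER FORM**: `D (M w) = w` and `⟪H (M w), δ⟫ = ⟪Λ w, D δ⟫` ⟹ `⟪M w, H (M w)⟫ = ⟪w, Λ w⟫` — the constrained Schur complement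
`Λ` («`(D H⁻¹ D†)⁻¹`») read WITHOUT inverses. [folklore] -/
theorem min_eq_multiplierForm (H : E →ₗ[ℝ] E) (D : E →ₗ[ℝ] F) (M : F → E) (hM : ∀ w, D (M w) = w) (Λ : F → F)
    (hΛ : ∀ (w : F) (δ : E), ⟪H (M w), δ⟫ = ⟪Λ w, D δ⟫) (w : F) : ⟪M w, H (M w)⟫ = ⟪w, Λ w⟫ := by
  rw [real_inner_comm, hΛ, hM, real_inner_comm]

/-- **END OF §3**: `H` symmetric `≥ 0`, `D (M w) = w`, `H M = D† Λ` in letter form ⟹ `⨅_{D δ = w} ⟪δ, H δ⟫ = ⟪w, Λ w⟫`. [folklore] -/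
theorem constrInf_quadForm_eq_multiplierForm (H : E →ₗ[ℝ] E) (hH : ∀ u v : E, ⟪H u, v⟫ = ⟪u, H v⟫) (hH0 : ∀ u : E, 0 ≤ ⟪u, H u⟫)
    (D : E →ₗ[ℝ] F) (M : F → E) (hM : ∀ w, D (M w) = w) (Λ : F → F) (hΛ : ∀ (w : F) (δ : E), ⟪H (M w), δ⟫ = ⟪Λ w, D δ⟫) (w : F) :
    (⨅ δ' : {δ' // D δ' = w}, ⟪δ'.1, H δ'.1⟫) = ⟪w, Λ w⟫ := by
  rw [constrInf_quadForm_eq H hH hH0 D M hM (lagrange_of_multiplier H D M Λ hΛ) w, min_eq_multiplierForm H D M hM Λ hΛ w]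

/-- Floor of the multiplier form from a floor of `H` (§2 + §3): `γ‖δ‖² ≤ ⟪δ, H δ⟫`, `‖D δ‖ ≤ q‖δ‖` ⟹ `(γ∕q²)·‖w‖² ≤ ⟪w, Λ w⟫`. [folklore] -/
theorem floor_multiplierForm (H : E →ₗ[ℝ] E) (hH : ∀ u v : E, ⟪H u, v⟫ = ⟪u, H v⟫) (D : E →ₗ[ℝ] F) (M : F → E) (hM : ∀ w, D (M w) = w)
    (Λ : F → F) (hΛ : ∀ (w : F) (δ : E), ⟪H (M w), δ⟫ = ⟪Λ w, D δ⟫) {γ q : ℝ} (hγ : 0 ≤ γ) (hq : 0 < q)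
    (hD : ∀ δ, ‖D δ‖ ≤ q * ‖δ‖) (hfloor : ∀ δ, γ * ‖δ‖ ^ 2 ≤ ⟪δ, H δ⟫) (w : F) : γ / q ^ 2 * ‖w‖ ^ 2 ≤ ⟪w, Λ w⟫ := by
  have hH0 : ∀ u : E, 0 ≤ ⟪u, H u⟫ := fun u => (mul_nonneg hγ (sq_nonneg _)).trans (hfloor u)
  rw [← constrInf_quadForm_eq_multiplierForm H hH hH0 D M hM Λ hΛ w]
  exact floor_constrInf (Q := fun δ => ⟪δ, H δ⟫) hγ hq hD hfloor ⟨M w, hM w⟩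

end Quadratic

/-! ## §4 Existence of the constrained minimiser and the multiplier map in finite dimension -/

section Existence

variable {E F : Type*} [NormedAddCommGroup E] [InnerProductSpace ℝ E] [NormedAddCommGroup F] [InnerProductSpace ℝ F]
  [FiniteDimensional ℝ E] [FiniteDimensional ℝ F]

/-- The adjoint of a SURJECTIVE map is injective (`D† w = 0 ⟹ w ⊥ range D = F`). [folklore] -/
theorem adjoint_injective_of_surjective (D : E →ₗ[ℝ] F) (hDs : Surjective D) : Injective (LinearMap.adjoint D) := by
  intro w₁ w₂ h
  rw [← sub_eq_zero] at h ⊢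
  rw [← map_sub] at h
  obtain ⟨δ, hδ⟩ := hDs (w₁ - w₂)
  have h0 : ⟪w₁ - w₂, w₁ - w₂⟫ = 0 :=
    calc ⟪w₁ - w₂, w₁ - w₂⟫ = ⟪w₁ - w₂, D δ⟫ := by rw [hδ]
      _ = ⟪LinearMap.adjoint D (w₁ - w₂), δ⟫ := (LinearMap.adjoint_inner_left _ _ _).symm
      _ = 0 := by rw [h, inner_zero_left]
  exact inner_self_eq_zero.1 h0

/-- **EXISTENCE OF `(M, Λ)`**: `H` positive definite (`0 < ⟪u, H u⟫` off `0`; symmetry is not even used) and `D` surjective ⟹ there are LINEAR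
`M : F →ₗ E`, `Λ : F →ₗ F` with `D (M w) = w` and `⟪H (M w), δ⟫ = ⟪Λ w, D δ⟫` — namely `Λ = (D H⁻¹ D†)⁻¹`, `M = H⁻¹ D† Λ` (`D H⁻¹ D†` is
positive definite on `F`, hence invertible). [folklore] -/
theorem exists_constrMin (H : E →ₗ[ℝ] E) (hHpos : ∀ u : E, u ≠ 0 → 0 < ⟪u, H u⟫) (D : E →ₗ[ℝ] F) (hDs : Surjective D) :
    ∃ (M : F →ₗ[ℝ] E) (Λ : F →ₗ[ℝ] F), (∀ w, D (M w) = w) ∧ ∀ (w : F) (δ : E), ⟪H (M w), δ⟫ = ⟪Λ w, D δ⟫ := by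
  -- a positive definite map on a finite-dimensional space is bijective (cf. `…ConvexityModulusSchur.bijective_of_inner_pos`)
  have hHb : Bijective H := by
    have hinj : Injective H := fun u v huv => by
      by_contra hne
      have hpos := hHpos (u - v) (sub_ne_zero.2 hne)
      rw [map_sub, huv, sub_self, inner_zero_right] at hpos
      exact lt_irrefl _ hpos
    exact ⟨hinj, LinearMap.surjective_of_injective hinj⟩
  set Hi : E →ₗ[ℝ] E := ((LinearEquiv.ofBijective H hHb).symm : E →ₗ[ℝ] E) with hHi
  have hHHi : ∀ u, H (Hi u) = u := fun u => (LinearEquiv.ofBijective H hHb).apply_symm_apply u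
  set G : F →ₗ[ℝ] F := D ∘ₗ Hi ∘ₗ LinearMap.adjoint D with hG
  -- `G = D H⁻¹ D†` is positive definite on `F`
  have hGpos : ∀ w : F, w ≠ 0 → 0 < ⟪w, G w⟫ := by
    intro w hw
    have hv : Hi (LinearMap.adjoint D w) ≠ 0 := by
      intro h0
      have : LinearMap.adjoint D w = 0 := by rw [← hHHi (LinearMap.adjoint D w), h0, map_zero]
      exact hw (adjoint_injective_of_surjective D hDs (by rw [this, map_zero]))
    have e : ⟪w, G w⟫ = ⟪Hi (LinearMap.adjoint D w), H (Hi (LinearMap.adjoint D w))⟫ := by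
      rw [hG, LinearMap.comp_apply, LinearMap.comp_apply, ← LinearMap.adjoint_inner_left, hHHi, real_inner_comm]
    rw [e]; exact hHpos _ hv
  have hGb : Bijective G := by
    have hinj : Injective G := fun u v huv => by
      by_contra hne
      have hpos := hGpos (u - v) (sub_ne_zero.2 hne)
      rw [map_sub, huv, sub_self, inner_zero_right] at hpos
      exact lt_irrefl _ hpos
    exact ⟨hinj, LinearMap.surjective_of_injective hinj⟩
  set Gi : F →ₗ[ℝ] F := ((LinearEquiv.ofBijective G hGb).symm : F →ₗ[ℝ] F) with hGi
  have hGGi : ∀ w, G (Gi w) = w := fun w => (LinearEquiv.ofBijective G hGb).apply_symm_apply w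
  refine ⟨Hi ∘ₗ LinearMap.adjoint D ∘ₗ Gi, Gi, fun w => ?_, fun w δ => ?_⟩
  · have := hGGi w
    rw [hG, LinearMap.comp_apply, LinearMap.comp_apply] at this
    simpa only [LinearMap.comp_apply] using this
  · rw [LinearMap.comp_apply, LinearMap.comp_apply, hHHi, LinearMap.adjoint_inner_left]

end Existence

/-! ## §5 The soft members are dominated by the hard one -/

section Soft

variable {E F : Type*} [NormedAddCommGroup F]

/-- **SOFT ≤ HARD**: for `0 ≤ a`, `⨅ δ, (Q δ + a‖D δ − w‖²) ≤ ⨅_{D δ = w} Q δ` on a non-empty fibre (`Q ≥ 0`). [folklore] -/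
theorem softInf_le_constrInf {D : E → F} {Q : E → ℝ} (hQ0 : ∀ δ, 0 ≤ Q δ) {a : ℝ} (ha : 0 ≤ a) {w : F} (hw : ∃ δ, D δ = w) :
    (⨅ δ, (Q δ + a * ‖D δ - w‖ ^ 2)) ≤ ⨅ δ' : {δ' // D δ' = w}, Q δ'.1 := by
  refine le_constrInf hw fun δ hδ => ?_
  calc (⨅ δ, (Q δ + a * ‖D δ - w‖ ^ 2)) ≤ Q δ + a * ‖D δ - w‖ ^ 2 :=
        ciInf_le ⟨0, forall_mem_range.2 fun δ' => add_nonneg (hQ0 δ') (mul_nonneg ha (sq_nonneg _))⟩ δ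
    _ = Q δ := by rw [hδ, sub_self, norm_zero]; ring

/-- The soft members increase with the weight: `a ≤ a'` ⟹ `⨅ δ, (Q δ + a‖D δ − w‖²) ≤ ⨅ δ, (Q δ + a'‖D δ − w‖²)` (`Q ≥ 0`, `0 ≤ a`). [folklore] -/
theorem softInf_mono [Nonempty E] {D : E → F} {Q : E → ℝ} (hQ0 : ∀ δ, 0 ≤ Q δ) {a a' : ℝ} (ha : 0 ≤ a) (haa' : a ≤ a') (w : F) :
    (⨅ δ, (Q δ + a * ‖D δ - w‖ ^ 2)) ≤ ⨅ δ, (Q δ + a' * ‖D δ - w‖ ^ 2) := by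
  refine le_ciInf fun δ => ?_
  calc (⨅ δ, (Q δ + a * ‖D δ - w‖ ^ 2)) ≤ Q δ + a * ‖D δ - w‖ ^ 2 :=
        ciInf_le ⟨0, forall_mem_range.2 fun δ' => add_nonneg (hQ0 δ') (mul_nonneg ha (sq_nonneg _))⟩ δ
    _ ≤ Q δ + a' * ‖D δ - w‖ ^ 2 := by nlinarith [sq_nonneg ‖D δ - w‖]

end Soft

/-! ## §6 THE MODULUS FORM SURVIVES THE CONSTRAINED MINIMISATION: the value function `w ↦ inf {V δ : δ ∈ K, D δ = w}` inherits the
secant letter with the CONSTRAINED SCHUR FORM of `Q` — the `a = ∞` (minimisation) twin of `…LogConcaveMarginal` §6's fluctuation-integral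
inheritance, for a general linear constraint map -/

section ValueFunction

variable {E F : Type*} [AddCommGroup E] [Module ℝ E] [AddCommGroup F] [Module ℝ F]

/-- **THE SECANT LETTER PASSES TO THE CONSTRAINED VALUE FUNCTION WITH THE CONSTRAINED SCHUR FORM.**  `K ⊆ E` convex, `V` bounded below on
`K` and obeying the secant letter with a non-negative modulus form `Q` on `K`
(`V (a p + b q) + a·b·Q (q − p) ≤ a V p + b V q`), `D : E →ₗ[ℝ] F` ⟹ the value function `φ w = ⨅ {V δ : δ ∈ K, D δ = w}` obeys, for
`w₁, w₂` with non-empty fibres in `K`, `φ (a w₁ + b w₂) + a·b·Q_D (w₂ − w₁) ≤ a φ w₁ + b φ w₂` with `Q_D v = ⨅_{D δ = v} Q δ` (§1).  Proof: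
`a δ₁ + b δ₂` lies in the fibre of `a w₁ + b w₂` and `Q (δ₂ − δ₁) ≥ Q_D (w₂ − w₁)`; minimise over `δ₁, δ₂`. [folklore] -/
theorem secant_constrInf_of_secant (D : E →ₗ[ℝ] F) {K : Set E} (hK : Convex ℝ K) {V Q : E → ℝ} (hQ0 : ∀ δ, 0 ≤ Q δ)
    (hbdd : ∃ m, ∀ δ ∈ K, m ≤ V δ)
    (hV : ∀ p ∈ K, ∀ q ∈ K, ∀ a b : ℝ, 0 ≤ a → 0 ≤ b → a + b = 1 → V (a • p + b • q) + a * b * Q (q - p) ≤ a * V p + b * V q)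
    {w₁ w₂ : F} (hw₁ : ∃ δ ∈ K, D δ = w₁) (hw₂ : ∃ δ ∈ K, D δ = w₂) {a b : ℝ} (ha : 0 ≤ a) (hb : 0 ≤ b) (hab : a + b = 1) :
    (⨅ δ' : {δ' // δ' ∈ K ∧ D δ' = a • w₁ + b • w₂}, V δ'.1) + a * b * (⨅ δ' : {δ' // D δ' = w₂ - w₁}, Q δ'.1)
      ≤ a * (⨅ δ' : {δ' // δ' ∈ K ∧ D δ' = w₁}, V δ'.1) + b * (⨅ δ' : {δ' // δ' ∈ K ∧ D δ' = w₂}, V δ'.1) := by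
  obtain ⟨m, hm⟩ := hbdd
  obtain ⟨e₁, he₁K, he₁⟩ := hw₁
  obtain ⟨e₂, he₂K, he₂⟩ := hw₂
  haveI : Nonempty {δ' // δ' ∈ K ∧ D δ' = w₁} := ⟨⟨e₁, he₁K, he₁⟩⟩
  haveI : Nonempty {δ' // δ' ∈ K ∧ D δ' = w₂} := ⟨⟨e₂, he₂K, he₂⟩⟩
  have hbddw : ∀ w, BddBelow (range fun δ' : {δ' // δ' ∈ K ∧ D δ' = w} => V δ'.1) :=
    fun w => ⟨m, forall_mem_range.2 fun δ' => hm δ'.1 δ'.2.1⟩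
  -- the two-point estimate on the fibres
  have key : ∀ (δ₁ : {δ' // δ' ∈ K ∧ D δ' = w₁}) (δ₂ : {δ' // δ' ∈ K ∧ D δ' = w₂}),
      (⨅ δ' : {δ' // δ' ∈ K ∧ D δ' = a • w₁ + b • w₂}, V δ'.1) + a * b * (⨅ δ' : {δ' // D δ' = w₂ - w₁}, Q δ'.1)
        ≤ a * V δ₁.1 + b * V δ₂.1 := by
    rintro ⟨δ₁, hδ₁K, hδ₁⟩ ⟨δ₂, hδ₂K, hδ₂⟩
    have hmem : a • δ₁ + b • δ₂ ∈ K ∧ D (a • δ₁ + b • δ₂) = a • w₁ + b • w₂ :=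
      ⟨hK hδ₁K hδ₂K ha hb hab, by rw [map_add, map_smul, map_smul, hδ₁, hδ₂]⟩
    have h1 : (⨅ δ' : {δ' // δ' ∈ K ∧ D δ' = a • w₁ + b • w₂}, V δ'.1) ≤ V (a • δ₁ + b • δ₂) :=
      ciInf_le (hbddw _) ⟨a • δ₁ + b • δ₂, hmem⟩
    have h2 : (⨅ δ' : {δ' // D δ' = w₂ - w₁}, Q δ'.1) ≤ Q (δ₂ - δ₁) :=
      constrInf_le hQ0 (by rw [map_sub, hδ₁, hδ₂])
    have h3 := hV δ₁ hδ₁K δ₂ hδ₂K a b ha hb hab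
    nlinarith [mul_nonneg ha hb]
  -- minimise over `δ₁`, then over `δ₂`
  have step1 : ∀ δ₂ : {δ' // δ' ∈ K ∧ D δ' = w₂},
      (⨅ δ' : {δ' // δ' ∈ K ∧ D δ' = a • w₁ + b • w₂}, V δ'.1) + a * b * (⨅ δ' : {δ' // D δ' = w₂ - w₁}, Q δ'.1) - b * V δ₂.1
        ≤ a * ⨅ δ' : {δ' // δ' ∈ K ∧ D δ' = w₁}, V δ'.1 := by
    intro δ₂
    rw [Real.mul_iInf_of_nonneg ha]
    exact le_ciInf fun δ₁ => by linarith [key δ₁ δ₂]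
  have step2 : (⨅ δ' : {δ' // δ' ∈ K ∧ D δ' = a • w₁ + b • w₂}, V δ'.1) + a * b * (⨅ δ' : {δ' // D δ' = w₂ - w₁}, Q δ'.1)
      - a * (⨅ δ' : {δ' // δ' ∈ K ∧ D δ' = w₁}, V δ'.1) ≤ b * ⨅ δ' : {δ' // δ' ∈ K ∧ D δ' = w₂}, V δ'.1 := by
    rw [Real.mul_iInf_of_nonneg hb]
    exact le_ciInf fun δ₂ => by linarith [step1 δ₂]
  linarith [step2]

end ValueFunction

/-! ## §7 (v2, appended; chair ι-X-CSTF-1) THE MULTIPLIER MAP IS SYMMETRIC AND POSITIVE — from the two letters alone, no inverse -/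

section MultiplierForm

variable {E F : Type*} [NormedAddCommGroup E] [InnerProductSpace ℝ E] [NormedAddCommGroup F] [InnerProductSpace ℝ F]

/-- **THE MULTIPLIER MAP IS SYMMETRIC**: `H` symmetric, `D (M w) = w`, `⟪H (M w), δ⟫ = ⟪Λ w, D δ⟫` ⟹ `⟪Λ u, w⟫ = ⟪u, Λ w⟫`
(`⟪Λ u, w⟫ = ⟪Λ u, D (M w)⟫ = ⟪H (M u), M w⟫ = ⟪M u, H (M w)⟫ = ⟪Λ w, D (M u)⟫ = ⟪Λ w, u⟫`). [folklore] -/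
theorem multiplier_symm (H : E →ₗ[ℝ] E) (hH : ∀ u v : E, ⟪H u, v⟫ = ⟪u, H v⟫) (D : E →ₗ[ℝ] F) (M : F → E)
    (hM : ∀ w, D (M w) = w) (Λ : F → F) (hΛ : ∀ (w : F) (δ : E), ⟪H (M w), δ⟫ = ⟪Λ w, D δ⟫) (u w : F) :
    ⟪Λ u, w⟫ = ⟪u, Λ w⟫ := by
  calc ⟪Λ u, w⟫ = ⟪Λ u, D (M w)⟫ := by rw [hM]
    _ = ⟪H (M u), M w⟫ := (hΛ u (M w)).symm
    _ = ⟪H (M w), M u⟫ := by rw [hH, real_inner_comm]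
    _ = ⟪Λ w, D (M u)⟫ := hΛ w (M u)
    _ = ⟪u, Λ w⟫ := by rw [hM, real_inner_comm]

/-- **THE MULTIPLIER FORM IS NON-NEGATIVE** when `H ≥ 0`: `0 ≤ ⟪w, Λ w⟫` (`= ⟪M w, H (M w)⟫`, §3). [folklore] -/
theorem multiplier_nonneg (H : E →ₗ[ℝ] E) (hH0 : ∀ u : E, 0 ≤ ⟪u, H u⟫) (D : E →ₗ[ℝ] F) (M : F → E) (hM : ∀ w, D (M w) = w)
    (Λ : F → F) (hΛ : ∀ (w : F) (δ : E), ⟪H (M w), δ⟫ = ⟪Λ w, D δ⟫) (w : F) : 0 ≤ ⟪w, Λ w⟫ := by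
  rw [← min_eq_multiplierForm H D M hM Λ hΛ w]; exact hH0 (M w)

/-- **THE MULTIPLIER FORM IS POSITIVE DEFINITE** when `H` is: `w ≠ 0 → 0 < ⟪w, Λ w⟫` (`M w ≠ 0` since `D (M w) = w ≠ 0`). So the constrained
Schur complement is a symmetric positive definite form on `F` — the letters a next-level consumer displays. [folklore] -/
theorem multiplier_pos (H : E →ₗ[ℝ] E) (hHpos : ∀ u : E, u ≠ 0 → 0 < ⟪u, H u⟫) (D : E →ₗ[ℝ] F) (M : F → E) (hM : ∀ w, D (M w) = w)
    (Λ : F → F) (hΛ : ∀ (w : F) (δ : E), ⟪H (M w), δ⟫ = ⟪Λ w, D δ⟫) {w : F} (hw : w ≠ 0) : 0 < ⟪w, Λ w⟫ := by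
  have hMw : M w ≠ 0 := fun h0 => hw (by rw [← hM w, h0, map_zero])
  rw [← min_eq_multiplierForm H D M hM Λ hΛ w]; exact hHpos (M w) hMw

end MultiplierForm

/-! ## Toy checks (kernel): the letters are not vacuous -/

/-- Toy for §3 on `ℝ² → ℝ`, `H = 1`, `D(δ₁, δ₂) = δ₁ + δ₂`: `M w = (w∕2, w∕2)`, `Λ w = w∕2` (`D H⁻¹ D† = 2`), and indeed on the fibre
`δ₁ + δ₂ = w`: `w²∕2 ≤ δ₁² + δ₂²`. -/
example (δ₁ δ₂ : ℝ) : (δ₁ + δ₂) ^ 2 / 2 ≤ δ₁ ^ 2 + δ₂ ^ 2 := by nlinarith [sq_nonneg (δ₁ - δ₂)]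

/-- Toy for §5: the soft member `inf_δ (δ² + a(δ − w)²) = a w²∕(1 + a)` is below the hard value `w²` (here at `a = 1`: `w²∕2 ≤ w²`). -/
example (w : ℝ) : w ^ 2 / 2 ≤ w ^ 2 := by nlinarith [sq_nonneg w]

end Summit.QuantumFields.BalabanUV.T4Continuum.NE7b.ConstrainedSchurForm
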